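import Summits.HodgeConjecture.HodgeConjecture.Theorems.K2E5QuatZetaAbsConvOfThetaBounds   -- ★ (β)-skeleton (p855681): sharp-rate version, `lintegral_Iic_exp_mul_lt_top`, `quatModule_unitsOne_mul_section`
import HarnessLib

/-!
# K2 ∕ E5 «TamagawaUnitary» — tier-2 file `K2E5QuatZetaAbsConvOfThetaBoundsRates`: the (β) CORE with ARBITRARY RATES `κ₁ < σ < κ₂` (the byte shape of K2E5-p01's `thetaTail_le_exp`)

Track B «K2-LIT», engine E5, crux H413 (`stmt-HodgeConjecture-24833`); seat K2E5-p07 (g0); sequel of ★ `K2E5QuatZetaAbsConvOfThetaBounds` (p855681) answering K2E5-p01 (g2)'s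
REPORT-FIRST of `K2E5QuatThetaBounds` (2026-09-03T23:42Z): the height-based theta bound (★ `AdelicThetaTailRayDecay`) gives the contracting side at ANY rate `κ > 1`
(`Σ_γ ‖Φ(y γ θ_t)‖ ≤ B_κ e^{−κ t}`, all `t`), not the sharp Poisson rate `1`.  That costs nothing: the version below takes the contracting bound at a rate `κ₁ < σ` and the
expanding bound at a rate `κ₂ > σ` (profile `e^{(σ−κ₁)t} 1_{t≤0} + e^{(σ−κ₂)t} 1_{t>0}`, integrable), so EVERY `σ > 1` is reached with `κ₁ := (1+σ)/2`, `κ₂ := σ + 1`: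
`quatZeta_majorant_integrable_of_thetaBounds_rates`, `quatZeta_integrable_of_thetaBounds_rates`.  Same proof (disintegration (H1), Weil-constant-one unfolding over `Γ_h`,
periodicity + covering set (H2), domination).  No `sorry`, axioms ⊆ the trio, no `instance`, no `notation`.

HONEST LABEL: HC_CM is proved only modulo the 7 printed citations (2 remaining named inputs: hLiu418 = stmt-HodgeConjecture-24832, h413 = stmt-HodgeConjecture-24833) until rung 0
closes; this file is a helper (`--supports stmt-HodgeConjecture-24833 --as helper`) and changes no count.

## References
[VignerasLNM800] M.-F. Vignéras, LNM 800 (1980), Ch. III §2 Thm. 2.2 · [WeilBNT1967] A. Weil, *Basic Number Theory* (1967), Ch. VII §5 Prop. 11 · [TateThesis1967] J. Tate, in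
Cassels–Fröhlich (1967), Ch. XV §4.4.
-/

set_option autoImplicit false
set_option linter.dupNamespace false

noncomputable section

namespace Summit.HodgeConjecture.HodgeConjecture.Cruxes.H413.K2E5QuatZetaAbsConvOfThetaBounds

open NumberField IsDedekindDomain MeasureTheory MeasureTheory.Measure Filter Topology Set
open scoped Matrix MatrixGroups NNReal ENNReal
open Literature.MeasureTheory.Group Literature.NumberTheory Literature.NumberTheory.Automorphic
open Summit.HodgeConjecture.HodgeConjecture.Cruxes.H413.K2E5QuatAdelicMatrixModel
open Summit.HodgeConjecture.HodgeConjecture.Cruxes.H413.K2E5QuatZeta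
open Summit.HodgeConjecture.HodgeConjecture.Cruxes.H413.K2E5QuatAdelicLattice
open Summit.HodgeConjecture.HodgeConjecture.Cruxes.H413.K2E5QuatAdelicModuleOne
open Summit.HodgeConjecture.HodgeConjecture.Cruxes.H413.K2E5QuatZetaAbsConvReduction

/-! ## §1 The two-rate profile -/

/-- `∫⁻_{t > 0} e^{a t} dt < ⊤` for `a < 0` (Mathlib `integrableOn_exp_mul_Ioi`). [folklore] -/
theorem lintegral_Ioi_exp_mul_lt_top {a : ℝ} (ha : a < 0) : ∫⁻ t in Ioi (0 : ℝ), ENNReal.ofReal (Real.exp (a * t)) < ⊤ := by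
  have h := (integrableOn_exp_mul_Ioi ha 0).hasFiniteIntegral
  rw [HasFiniteIntegral] at h
  refine lt_of_le_of_lt (lintegral_mono fun t => ?_) h
  rw [Real.enorm_eq_ofReal (Real.exp_nonneg _)]

/-- **The two-rate profile** `e^{(σ−κ₁)t} 1_{t≤0} + e^{(σ−κ₂)t} 1_{t>0}` has finite `∫⁻` when `κ₁ < σ < κ₂`. [cite: TateThesis1967, §4.4] -/
theorem lintegral_ratesProfile_lt_top {σ κ₁ κ₂ : ℝ} (hκ₁ : κ₁ < σ) (hκ₂ : σ < κ₂) :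
    ∫⁻ t : ℝ, ((Iic (0 : ℝ)).indicator (fun t => ENNReal.ofReal (Real.exp ((σ - κ₁) * t))) t +
        (Ioi (0 : ℝ)).indicator (fun t => ENNReal.ofReal (Real.exp ((σ - κ₂) * t))) t) < ⊤ := by
  rw [lintegral_add_left (Measurable.indicator (by fun_prop) measurableSet_Iic), lintegral_indicator measurableSet_Iic,
    lintegral_indicator measurableSet_Ioi]
  exact ENNReal.add_lt_top.2 ⟨lintegral_Iic_exp_mul_lt_top (by linarith), lintegral_Ioi_exp_mul_lt_top (by linarith)⟩

/-- Pointwise domination `e^{σt} · b(t) ≤ (B⁻ + B⁺) · profile(t)` for `b(t) = B⁻ e^{−κ₁ t}` (`t ≤ 0`), `B⁺ e^{−κ₂ t}` (`t > 0`). [folklore] -/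
theorem exp_mul_bound_le_ratesProfile (σ κ₁ κ₂ : ℝ) (Bm Bp : ℝ≥0∞) (t : ℝ) :
    ENNReal.ofReal (Real.exp (σ * t)) *
        (if t ≤ 0 then Bm * ENNReal.ofReal (Real.exp (-κ₁ * t)) else Bp * ENNReal.ofReal (Real.exp (-κ₂ * t))) ≤
      (Bm + Bp) * ((Iic (0 : ℝ)).indicator (fun t => ENNReal.ofReal (Real.exp ((σ - κ₁) * t))) t +
        (Ioi (0 : ℝ)).indicator (fun t => ENNReal.ofReal (Real.exp ((σ - κ₂) * t))) t) := by
  by_cases ht : t ≤ 0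
  · rw [if_pos ht, indicator_of_mem (mem_Iic.2 ht), indicator_of_notMem (fun h : t ∈ Ioi (0 : ℝ) => not_lt.2 ht (mem_Ioi.1 h)), add_zero,
      mul_left_comm, ← ENNReal.ofReal_mul (Real.exp_nonneg _), ← Real.exp_add,
      show σ * t + -κ₁ * t = (σ - κ₁) * t by ring]
    exact mul_le_mul' le_self_add le_rfl
  · have ht' : 0 < t := lt_of_not_ge ht
    rw [if_neg ht, indicator_of_notMem (fun h : t ∈ Iic (0 : ℝ) => ht (mem_Iic.1 h)), indicator_of_mem (mem_Ioi.2 ht'), zero_add,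
      mul_left_comm, ← ENNReal.ofReal_mul (Real.exp_nonneg _), ← Real.exp_add,
      show σ * t + -κ₂ * t = (σ - κ₂) * t by ring]
    exact mul_le_mul' le_add_self le_rfl

/-! ## §2 The core estimate with rates -/

section Core

set_option synthInstance.maxHeartbeats 400000
set_option maxHeartbeats 1600000

variable (L : Type) [Field L] [NumberField L] [IsCMField L] {Ha : Matrix (Fin 2) (Fin 2) L}
  (hHa : (Ha.map (cmConjRingHom L)).transpose = Ha) (hdet : Ha.det ≠ 0)
  [MeasurableSpace (GL (Fin 2) (AdeleRing (𝓞 L) L))] [BorelSpace (GL (Fin 2) (AdeleRing (𝓞 L) L))]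
  [MeasurableSpace (↥(quatAdelicUnitsOne L Ha) ⧸ quatRatLatticeOne L Ha)] [BorelSpace (↥(quatAdelicUnitsOne L Ha) ⧸ quatRatLatticeOne L Ha)]
  [LocallyCompactSpace ↥(quatAdelicUnitsOne L Ha)] [SecondCountableTopology ↥(quatAdelicUnitsOne L Ha)] [T2Space ↥(quatAdelicUnitsOne L Ha)]

/-- **THE CORE ESTIMATE WITH RATES, modulo (H1)–(H3±)**: if the contracting-side theta bound holds at SOME rate `κ₁ < σ` and the expanding-side one at SOME rate `κ₂ > σ`,
the real majorant `‖Φ x‖ · |det x|_𝔸^σ` is `dx`-integrable on `(D_h ⊗ 𝔸)^×` (K2E5-p01's `thetaTail_le_exp` supplies every rate `κ > 1`, so every `σ > 1` is covered: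
`κ₁ := (1+σ)/2`, `κ₂ := σ + 1`).
[cite: VignerasLNM800, Ch. III §2 Thm. 2.2] [cite: WeilBNT1967, Ch. VII §5 Prop. 11] [cite: TateThesis1967, §4.4] -/
theorem quatZeta_majorant_integrable_of_thetaBounds_rates
    (dx : Measure ↥(quatAdelicUnits L Ha))
    (dx1 : Measure ↥(quatAdelicUnitsOne L Ha)) [dx1.IsHaarMeasure] [dx1.IsMulRightInvariant]
    [(count : Measure ↥(quatRatLatticeOne L Ha)).IsHaarMeasure]
    -- (H1) Tate's disintegration `dx = dx¹ ⊗ dt` (verbatim the hypothesis of socket G3)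
    (hdis : ∀ f : ↥(quatAdelicUnits L Ha) → ℝ≥0∞, Measurable f →
      ∫⁻ x, f x ∂dx = ∫⁻ t : ℝ, ∫⁻ y, f ((y : ↥(quatAdelicUnits L Ha)) *
        quatModuleSection L Ha (Units.mk0 (Real.toNNReal (Real.exp t)) (Real.toNNReal_pos.2 (Real.exp_pos t)).ne')) ∂dx1)
    -- (H2) finite covolume of `Γ_h` and a set meeting every coset
    (hcov : quotientMeasure (quatRatLatticeOne L Ha) (count : Measure ↥(quatRatLatticeOne L Ha)) (isClosed_quatRatLatticeOne L Ha) dx1 Set.univ < ⊤)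
    (K : Set ↥(quatAdelicUnitsOne L Ha)) (hK : ∀ y : ↥(quatAdelicUnitsOne L Ha), ∃ γ : ↥(quatRatLatticeOne L Ha), y * γ ∈ K)
    {Φ : Matrix (Fin 2) (Fin 2) (AdeleRing (𝓞 L) L) → ℂ}
    (hΦ : Φ ∈ quatSchwartzBruhat L (fun i => ((quatBasis L Ha hHa hdet i : ↥(quatRatSubalgebra L Ha)) : Matrix (Fin 2) (Fin 2) L)))
    {σ κ₁ κ₂ : ℝ} (hκ₁ : κ₁ < σ) (hκ₂ : σ < κ₂)
    -- (H3⁻) contracting-side theta bound at rate `κ₁`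
    (hminus : ∃ B : ℝ≥0∞, B ≠ ⊤ ∧ ∀ y ∈ K, ∀ t : ℝ, t ≤ 0 →
      (∑' γ : ↥(quatRatLatticeOne L Ha), ‖Φ (((((y * γ : ↥(quatAdelicUnitsOne L Ha)) : ↥(quatAdelicUnits L Ha)) *
          quatModuleSection L Ha (Units.mk0 (Real.toNNReal (Real.exp t)) (Real.toNNReal_pos.2 (Real.exp_pos t)).ne') :
            GL (Fin 2) (AdeleRing (𝓞 L) L)) : Matrix (Fin 2) (Fin 2) (AdeleRing (𝓞 L) L)))‖ₑ) ≤ B * ENNReal.ofReal (Real.exp (-κ₁ * t)))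
    -- (H3⁺) expanding-side theta bound at rate `κ₂`
    (hplus : ∃ B : ℝ≥0∞, B ≠ ⊤ ∧ ∀ y ∈ K, ∀ t : ℝ, 0 < t →
      (∑' γ : ↥(quatRatLatticeOne L Ha), ‖Φ (((((y * γ : ↥(quatAdelicUnitsOne L Ha)) : ↥(quatAdelicUnits L Ha)) *
          quatModuleSection L Ha (Units.mk0 (Real.toNNReal (Real.exp t)) (Real.toNNReal_pos.2 (Real.exp_pos t)).ne') :
            GL (Fin 2) (AdeleRing (𝓞 L) L)) : Matrix (Fin 2) (Fin 2) (AdeleRing (𝓞 L) L)))‖ₑ) ≤ B * ENNReal.ofReal (Real.exp (-κ₂ * t))) :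
    Integrable (fun x : ↥(quatAdelicUnits L Ha) =>
      ‖Φ ((x : GL (Fin 2) (AdeleRing (𝓞 L) L)) : Matrix (Fin 2) (Fin 2) (AdeleRing (𝓞 L) L))‖ * ((quatModule L Ha x : ℝ≥0) : ℝ) ^ σ) dx := by
  obtain ⟨Bm, hBm, hm⟩ := hminus
  obtain ⟨Bp, hBp, hp⟩ := hplus
  haveI : IsClosed ((quatRatLatticeOne L Ha : Subgroup ↥(quatAdelicUnitsOne L Ha)) : Set ↥(quatAdelicUnitsOne L Ha)) := isClosed_quatRatLatticeOne L Ha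
  haveI : Countable ↥(quatRatLatticeOne L Ha) := countable_quatRatLatticeOne L Ha
  haveI : DiscreteTopology ↥(quatRatLatticeOne L Ha) := discreteTopology_quatRatLatticeOne L Ha
  haveI : MeasurableSingletonClass ↥(quatRatLatticeOne L Ha) := by
    haveI : T2Space ↥(quatRatLatticeOne L Ha) := inferInstance
    infer_instance
  -- notation: θ_t, the test function on units, the fibre sum
  set θ : ℝ → ↥(quatAdelicUnits L Ha) := fun t =>
    quatModuleSection L Ha (Units.mk0 (Real.toNNReal (Real.exp t)) (Real.toNNReal_pos.2 (Real.exp_pos t)).ne') with hθ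
  set φ : ↥(quatAdelicUnits L Ha) → ℝ≥0∞ := fun x =>
    ‖Φ ((x : GL (Fin 2) (AdeleRing (𝓞 L) L)) : Matrix (Fin 2) (Fin 2) (AdeleRing (𝓞 L) L))‖ₑ with hφ
  have hφc : Continuous φ := (continuous_testFunction_restrict L hHa hdet hΦ).enorm
  -- the majorant in `ℝ≥0∞`
  set F : ↥(quatAdelicUnits L Ha) → ℝ≥0∞ := fun x => φ x * ENNReal.ofReal (((quatModule L Ha x : ℝ≥0) : ℝ) ^ σ) with hF
  have hFm : Measurable F :=
    hφc.measurable.mul (ENNReal.measurable_ofReal.comp ((continuous_quatModule L Ha).rpow_const fun x => Or.inl (quatModule_pos L Ha x).ne').measurable)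
  -- the bound `b(t)`
  set b : ℝ → ℝ≥0∞ := fun t => if t ≤ 0 then Bm * ENNReal.ofReal (Real.exp (-κ₁ * t)) else Bp * ENNReal.ofReal (Real.exp (-κ₂ * t)) with hb
  -- STEP 1: the fibre sums are bounded by `b(t)` at EVERY point (periodicity + the covering set `K`)
  have hfib : ∀ (t : ℝ) (y : ↥(quatAdelicUnitsOne L Ha)),
      fiberLIntegral (quatRatLatticeOne L Ha) (count : Measure ↥(quatRatLatticeOne L Ha))
        (fun y : ↥(quatAdelicUnitsOne L Ha) => φ ((y : ↥(quatAdelicUnits L Ha)) * θ t)) (QuotientGroup.mk y) ≤ b t := by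
    intro t y
    obtain ⟨γ₀, hγ₀⟩ := hK y
    rw [K2E5HaarCovolTower.fiberLIntegral_count_mk]
    -- reindex the `Γ_h`-sum by `γ ↦ γ₀ γ`
    have hre : (∑' γ : ↥(quatRatLatticeOne L Ha), φ (((y * γ : ↥(quatAdelicUnitsOne L Ha)) : ↥(quatAdelicUnits L Ha)) * θ t)) =
        ∑' γ : ↥(quatRatLatticeOne L Ha), φ ((((y * γ₀) * γ : ↥(quatAdelicUnitsOne L Ha)) : ↥(quatAdelicUnits L Ha)) * θ t) := by
      rw [← (Equiv.mulLeft γ₀).tsum_eq]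
      refine tsum_congr fun γ => ?_
      simp only [Equiv.coe_mulLeft, Subgroup.coe_mul, mul_assoc]
    rw [hre]
    by_cases ht : t ≤ 0
    · simp only [hb, if_pos ht]
      exact hm (y * γ₀) hγ₀ t ht
    · simp only [hb, if_neg ht]
      exact hp (y * γ₀) hγ₀ t (lt_of_not_ge ht)
  -- STEP 2: the inner integral over `D¹` is at most `V · b(t)` (Weil-constant-one unfolding over `Γ_h`)
  have hinner : ∀ t : ℝ, ∫⁻ y, φ ((y : ↥(quatAdelicUnits L Ha)) * θ t) ∂dx1 ≤
      quotientMeasure (quatRatLatticeOne L Ha) (count : Measure ↥(quatRatLatticeOne L Ha)) (isClosed_quatRatLatticeOne L Ha) dx1 Set.univ * b t := by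
    intro t
    have hmeas : Measurable fun y : ↥(quatAdelicUnitsOne L Ha) => φ ((y : ↥(quatAdelicUnits L Ha)) * θ t) :=
      hφc.measurable.comp (continuous_subtype_val.mul continuous_const).measurable
    rw [← lintegral_fiberLIntegral_quotientMeasure (quatRatLatticeOne L Ha) (count : Measure ↥(quatRatLatticeOne L Ha)) dx1 hmeas]
    calc ∫⁻ q, fiberLIntegral (quatRatLatticeOne L Ha) (count : Measure ↥(quatRatLatticeOne L Ha))
            (fun y : ↥(quatAdelicUnitsOne L Ha) => φ ((y : ↥(quatAdelicUnits L Ha)) * θ t)) q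
          ∂quotientMeasure (quatRatLatticeOne L Ha) (count : Measure ↥(quatRatLatticeOne L Ha)) (isClosed_quatRatLatticeOne L Ha) dx1
        ≤ ∫⁻ _, b t ∂quotientMeasure (quatRatLatticeOne L Ha) (count : Measure ↥(quatRatLatticeOne L Ha)) (isClosed_quatRatLatticeOne L Ha) dx1 := by
          refine lintegral_mono fun q => ?_
          induction q using QuotientGroup.induction_on with
          | H y => exact hfib t y
      _ = quotientMeasure (quatRatLatticeOne L Ha) (count : Measure ↥(quatRatLatticeOne L Ha)) (isClosed_quatRatLatticeOne L Ha) dx1 Set.univ * b t := by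
          rw [lintegral_const, mul_comm]
  -- STEP 3: disintegrate and dominate by the Tate profile
  set V : ℝ≥0∞ := quotientMeasure (quatRatLatticeOne L Ha) (count : Measure ↥(quatRatLatticeOne L Ha)) (isClosed_quatRatLatticeOne L Ha) dx1 Set.univ with hV
  have hstep : ∀ t : ℝ, ∫⁻ y, F ((y : ↥(quatAdelicUnits L Ha)) * θ t) ∂dx1 ≤
      V * (Bm + Bp) * ((Iic (0 : ℝ)).indicator (fun t => ENNReal.ofReal (Real.exp ((σ - κ₁) * t))) t +
        (Ioi (0 : ℝ)).indicator (fun t => ENNReal.ofReal (Real.exp ((σ - κ₂) * t))) t) := by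
    intro t
    have hmeas : Measurable fun y : ↥(quatAdelicUnitsOne L Ha) => φ ((y : ↥(quatAdelicUnits L Ha)) * θ t) :=
      hφc.measurable.comp (continuous_subtype_val.mul continuous_const).measurable
    have hFt : (fun y : ↥(quatAdelicUnitsOne L Ha) => F ((y : ↥(quatAdelicUnits L Ha)) * θ t)) =
        fun y : ↥(quatAdelicUnitsOne L Ha) => ENNReal.ofReal (Real.exp (σ * t)) * φ ((y : ↥(quatAdelicUnits L Ha)) * θ t) := by
      funext y
      simp only [hF]
      rw [mul_comm]
      congr 1
      simp only [hθ]
      rw [quatModule_unitsOne_mul_section L y t, ← Real.exp_mul, mul_comm t σ]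
    rw [hFt, lintegral_const_mul _ hmeas]
    calc ENNReal.ofReal (Real.exp (σ * t)) * ∫⁻ y, φ ((y : ↥(quatAdelicUnits L Ha)) * θ t) ∂dx1
        ≤ ENNReal.ofReal (Real.exp (σ * t)) * (V * b t) := mul_le_mul' le_rfl (hinner t)
      _ = V * (ENNReal.ofReal (Real.exp (σ * t)) * b t) := by rw [mul_left_comm]
      _ ≤ V * ((Bm + Bp) * ((Iic (0 : ℝ)).indicator (fun t => ENNReal.ofReal (Real.exp ((σ - κ₁) * t))) t +
            (Ioi (0 : ℝ)).indicator (fun t => ENNReal.ofReal (Real.exp ((σ - κ₂) * t))) t)) :=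
          mul_le_mul' le_rfl (exp_mul_bound_le_ratesProfile σ κ₁ κ₂ Bm Bp t)
      _ = _ := (mul_assoc _ _ _).symm
  have hlt : ∫⁻ x, F x ∂dx < ⊤ := by
    rw [hdis F hFm]
    refine lt_of_le_of_lt (lintegral_mono hstep) ?_
    rw [lintegral_const_mul' _ _ (ENNReal.mul_ne_top hcov.ne (ENNReal.add_ne_top.2 ⟨hBm, hBp⟩))]
    exact ENNReal.mul_lt_top (ENNReal.mul_lt_top hcov (ENNReal.add_lt_top.2 ⟨hBm.lt_top, hBp.lt_top⟩)) (lintegral_ratesProfile_lt_top hκ₁ hκ₂)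
  -- conclusion: a.e.-strongly measurable with finite integral
  refine ⟨(continuous_quatZeta_majorant L hHa hdet hΦ σ).aestronglyMeasurable, ?_⟩
  refine lt_of_le_of_lt (lintegral_mono fun x => le_of_eq ?_) hlt
  rw [enorm_mul, enorm_norm, Real.enorm_eq_ofReal (by positivity)]

/-- **THE DEALT STATEMENT WITH RATES, modulo (H1)–(H3±)**: under the same hypotheses the `quatZeta` integrand `Φ(x) |det x|_𝔸^s` is `dx`-integrable for the real `s = σ`
(★ (α) `integrable_quatZeta_integrand_iff`). [cite: VignerasLNM800, Ch. III §2 Thm. 2.2] -/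
theorem quatZeta_integrable_of_thetaBounds_rates
    (dx : Measure ↥(quatAdelicUnits L Ha))
    (dx1 : Measure ↥(quatAdelicUnitsOne L Ha)) [dx1.IsHaarMeasure] [dx1.IsMulRightInvariant]
    [(count : Measure ↥(quatRatLatticeOne L Ha)).IsHaarMeasure]
    (hdis : ∀ f : ↥(quatAdelicUnits L Ha) → ℝ≥0∞, Measurable f →
      ∫⁻ x, f x ∂dx = ∫⁻ t : ℝ, ∫⁻ y, f ((y : ↥(quatAdelicUnits L Ha)) *
        quatModuleSection L Ha (Units.mk0 (Real.toNNReal (Real.exp t)) (Real.toNNReal_pos.2 (Real.exp_pos t)).ne')) ∂dx1)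
    (hcov : quotientMeasure (quatRatLatticeOne L Ha) (count : Measure ↥(quatRatLatticeOne L Ha)) (isClosed_quatRatLatticeOne L Ha) dx1 Set.univ < ⊤)
    (K : Set ↥(quatAdelicUnitsOne L Ha)) (hK : ∀ y : ↥(quatAdelicUnitsOne L Ha), ∃ γ : ↥(quatRatLatticeOne L Ha), y * γ ∈ K)
    {Φ : Matrix (Fin 2) (Fin 2) (AdeleRing (𝓞 L) L) → ℂ}
    (hΦ : Φ ∈ quatSchwartzBruhat L (fun i => ((quatBasis L Ha hHa hdet i : ↥(quatRatSubalgebra L Ha)) : Matrix (Fin 2) (Fin 2) L)))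
    {σ κ₁ κ₂ : ℝ} (hκ₁ : κ₁ < σ) (hκ₂ : σ < κ₂)
    (hminus : ∃ B : ℝ≥0∞, B ≠ ⊤ ∧ ∀ y ∈ K, ∀ t : ℝ, t ≤ 0 →
      (∑' γ : ↥(quatRatLatticeOne L Ha), ‖Φ (((((y * γ : ↥(quatAdelicUnitsOne L Ha)) : ↥(quatAdelicUnits L Ha)) *
          quatModuleSection L Ha (Units.mk0 (Real.toNNReal (Real.exp t)) (Real.toNNReal_pos.2 (Real.exp_pos t)).ne') :
            GL (Fin 2) (AdeleRing (𝓞 L) L)) : Matrix (Fin 2) (Fin 2) (AdeleRing (𝓞 L) L)))‖ₑ) ≤ B * ENNReal.ofReal (Real.exp (-κ₁ * t)))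
    (hplus : ∃ B : ℝ≥0∞, B ≠ ⊤ ∧ ∀ y ∈ K, ∀ t : ℝ, 0 < t →
      (∑' γ : ↥(quatRatLatticeOne L Ha), ‖Φ (((((y * γ : ↥(quatAdelicUnitsOne L Ha)) : ↥(quatAdelicUnits L Ha)) *
          quatModuleSection L Ha (Units.mk0 (Real.toNNReal (Real.exp t)) (Real.toNNReal_pos.2 (Real.exp_pos t)).ne') :
            GL (Fin 2) (AdeleRing (𝓞 L) L)) : Matrix (Fin 2) (Fin 2) (AdeleRing (𝓞 L) L)))‖ₑ) ≤ B * ENNReal.ofReal (Real.exp (-κ₂ * t))) :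
    Integrable (fun x : ↥(quatAdelicUnits L Ha) =>
      Φ ((x : GL (Fin 2) (AdeleRing (𝓞 L) L)) : Matrix (Fin 2) (Fin 2) (AdeleRing (𝓞 L) L)) * (((quatModule L Ha x : ℝ≥0) : ℝ) : ℂ) ^ (σ : ℂ)) dx :=
  (integrable_quatZeta_integrand_iff L hHa hdet hΦ dx σ).2
    (quatZeta_majorant_integrable_of_thetaBounds_rates L hHa hdet dx dx1 hdis hcov K hK hΦ hκ₁ hκ₂ hminus hplus)

end Core

end Summit.HodgeConjecture.HodgeConjecture.Cruxes.H413.K2E5QuatZetaAbsConvOfThetaBounds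

end
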